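/-
Copyright (c) 2026 the pub-hodgecm-mathlib formalisation cell (harness21).  Prover seat hodgecm-mathlib-K2Liu-p09 (g7): Track B «K2-LIT»,
hLiu418 = stmt-HodgeConjecture-24832; LEAD F0P6-plan RULINGS M-158d «A7-val road (σ)» and σ19∕σ21 «(Sp): the tail organ is OFF the closing path» — the S glue
`hne_of_sum_witness` (LEAD 2026-09-04T14:21:32Z: «yours or p07's»).
-/
import Summits.HodgeConjecture.HodgeConjecture.Theorems.K2LiuA7ValueMap      -- ★ V8a p859922 (`exists_valueMap`; brings ★ V1d `exists_flatFamily`, ★ V1 `value_unique`)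
import HarnessLib

/-!
# Crux `HLiu418`, road `K2_Liu`, organ A7-val, σ19-(Sp) glue: A NON-VANISHING VALUE ON A SUM OF SECTIONS GIVES A NON-VANISHING VALUE ON ONE SUMMAND

Cell `hodgecm-mathlib`, crux item hLiu418 = `stmt-HodgeConjecture-24832`; squad K2 ∕ K2Liu; prover K2Liu-p09 (g7), organ lead A7-val.  THEOREMS ONLY; lane
`--supports stmt-HodgeConjecture-24832` (count-neutral helper).  RANK-GENERIC, frame-free, every finite place; HYPOTHESIS-FIRST in the (A4′-R) face (`hA4R`, ★ A7-reg
`normalisedRegularity_cm` at the CM datum, EVERY section — LEAD σ21 «YES») and the half-plane integrability (`hintA`, ★ V1c), exactly as ★ V8a `exists_valueMap`.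

THE POINT (RULING σ19∕σ21).  The (Sp) road to V8e's witness binder `hne` never evaluates `M(s)` on a tailed family: a big-cell section `f_bc ∈ I_v(½, χ_v)` with known
non-zero value `ℳ♮(f_bc)(1) = Λ · b₂∕a₂ ≠ 0` (★ V7a∕V7b) decomposes as `𝒜⁺Φ + 𝒜⁻Ψ` (Kudla–Sweet at `n = 2`), the `K₀`-flat extension is LINEAR in the `s = ½` value and `M(s)`
is linear, so `ℳ♮(f_bc) = ℳ♮(𝒜⁺Φ) + ℳ♮(𝒜⁻Ψ)` (★ V8a: the value MAP is `ℂ`-linear, well defined by ★ V1 `value_unique`) ⇒ ONE summand has `ℳ♮ ≠ 0` at `1`.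
* **`valueMap_apply_ne_zero_or`** — for any admissible (flat, smooth, Siegel) family `f` through `φ₁ + φ₂` with (A4′-R) datum `Fn` and `Fn(½)(h₀) ≠ 0`, there is an admissible
  family through `φ₁` OR through `φ₂` whose datum does not vanish at `(½, h₀)` — in the exact tuple currency `(f, Fn)` of ★ V8e's `hne` ∕ ★ V8g.
* **`hne_of_sum_witness`** — the same at `h₀ = 1` with the two summands `𝒜⁺ Φ`, `𝒜⁻ Ψ` of two section maps `𝒜⁺ : V⁺ →ₗ I_v(½)`, `𝒜⁻ : V⁻ →ₗ I_v(½)` (V8e's `𝒜`-currency).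
HONEST LABEL.  `HC_CM` is proved only modulo the 7 printed citations (2 remaining named inputs: hLiu418 = `stmt-HodgeConjecture-24832`,
h413 = `stmt-HodgeConjecture-24833`) until rung 0 closes.

## References
* [KudlaSweet1997] S. Kudla, W. J. Sweet, Israel J. Math. 98 (1997), §1, Thm. 1.2 (`I_n(0, χ) = R(V⁺) ⊕ R(V⁻)` and the normalised intertwining operator).
* [HarrisKudlaSweet1996] M. Harris, S. Kudla, W. J. Sweet, J. AMS 9 (1996), §6 (6.16).
* [Casselman1980] W. Casselman, Compositio Math. 40 (1980), §3 (flat sections).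
-/

set_option autoImplicit false
set_option linter.dupNamespace false -- the mandated namespace repeats `HodgeConjecture.HodgeConjecture`

noncomputable section

open scoped Classical
open NumberField IsDedekindDomain MeasureTheory
open Literature.NumberTheory.GaloisRepresentations.IsNonarchimedeanLocalField
open Literature.NumberTheory.Automorphic Literature.NumberTheory.Automorphic.UnitaryGroup
open Literature.NumberTheory.GelbartRogawski1991.UnitaryDualPair.LocalSplitting
open Literature.NumberTheory.K2Lit.LocalSiegelDoubled
open Summit.HodgeConjecture.HodgeConjecture.Cruxes.HLiu418.K2LiuQRationalDefs
open Summit.HodgeConjecture.HodgeConjecture.Cruxes.HLiu418.K2LiuLocalLFactorDefs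
open Summit.HodgeConjecture.HodgeConjecture.Cruxes.HLiu418.K2LiuLocalSiegel
open Summit.HodgeConjecture.HodgeConjecture.Cruxes.HLiu418.K2LiuA7ValueSiegelLaw
open Summit.HodgeConjecture.HodgeConjecture.Cruxes.HLiu418.K2LiuA7ValueMap

namespace Summit.HodgeConjecture.HodgeConjecture.Cruxes.HLiu418.K2LiuA7ValueSumWitness

variable (F : Type) [Field F] [NumberField F] (E : Type) [Field E] [NumberField E] [Algebra F E]
  [Algebra.IsQuadraticExtension F E] (c : E ≃ₐ[F] E)
  {δ : E} (hcδ : c δ = -δ) (hδ : δ ≠ 0) {d : F} (hd : δ * δ = algebraMap F E d) (v : HeightOneSpectrum (𝓞 F)) (n : ℕ)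
  {T₀ : Matrix (Fin n) (Fin n) F} (hT₀ : T₀.IsSymm) {JD : Matrix (Fin (n + n)) (Fin (n + n)) E} (hJD : JD = (gramD F n T₀).map (algebraMap F E))
  (χv : ∀ w : PlacesOver E v, (w.1.adicCompletion E)ˣ →* ℂˣ)
  [MeasurableSpace (unipDeltaLocal F E c v n (JD := JD))] (νN : Measure (unipDeltaLocal F E c v n (JD := JD))) (vol : ℝ)
  (haN : ∀ s : ℂ, 1 < s.re → aNorm F E c v n χv vol s ≠ 0)
  (K₀ : Subgroup (UnitaryGroup.localPi E c (n + n) JD v))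
  (hK₀ : IsCompact (K₀ : Set (UnitaryGroup.localPi E c (n + n) JD v)) ∧ IsOpen (K₀ : Set (UnitaryGroup.localPi E c (n + n) JD v)))
  (hIw : ∀ x : UnitaryGroup.localPi E c (n + n) JD v, ∃ p, IsSiegelDelta F E c hcδ hδ hd v n hT₀ hJD p ∧ ∃ k ∈ K₀, x = p * k)
  -- the (A4′-R) face in ∀∃-shape (★ B7 ∕ ★ A7-reg) and the half-plane integrability (★ V1c at `n = 2`), as ★ V8a
  (hA4R : ∀ f' : ℂ → UnitaryGroup.localPi E c (n + n) JD v → ℂ, (∀ s, IsLocalSiegelSection F E c hcδ hδ hd v n hT₀ hJD χv s (f' s)) →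
    (∀ s, IsSmooth F E c v n (f' s)) → (∀ s s' : ℂ, ∀ k ∈ K₀, f' s k = f' s' k) →
    ∃ Fn' : ℂ → UnitaryGroup.localPi E c (n + n) JD v → ℂ, (∀ h, IsQRationalRegularAt (residueFieldCard (v.adicCompletion F)) (1 / 2) fun s => Fn' s h) ∧
      ∀ s : ℂ, 1 < s.re → ∀ h, localIntertwining F E c v n hJD νN (f' s) h = aNorm F E c v n χv vol s * Fn' s h)
  (hintA : ∀ f' : ℂ → UnitaryGroup.localPi E c (n + n) JD v → ℂ, (∀ s, IsLocalSiegelSection F E c hcδ hδ hd v n hT₀ hJD χv s (f' s)) →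
    (∀ s, IsSmooth F E c v n (f' s)) → (∀ s s' : ℂ, ∀ k ∈ K₀, f' s k = f' s' k) → ∀ s : ℂ, 1 < s.re → ∀ h,
      Integrable (fun u : unipDeltaLocal F E c v n (JD := JD) => f' s (weylDelta F E c v n hJD * (u : UnitaryGroup.localPi E c (n + n) JD v) * h)) νN)

include hcδ hδ hd hT₀ hJD hK₀ hIw hA4R in
/-- **THE WITNESS OF ONE SUMMAND** — a `K₀`-flat smooth Siegel section `φ` through which some admissible family has (A4′-R) datum non-vanishing at `(½, h₀)` whenever the value map
does not vanish there: `ℳ φ h₀ ≠ 0 ⇒ ∃ (f, Fn) admissible through φ, Fn(½)(h₀) ≠ 0` (★ V1d `exists_flatFamily`, `hA4R`, ★ V8a). [cite: KudlaSweet1997, §1] [cite: Casselman1980, §3] -/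
theorem exists_witness_of_valueMap_ne_zero
    (ℳ : ↥(localDegPS F E c hcδ hδ hd v n hT₀ hJD χv (1 / 2)) →ₗ[ℂ] (UnitaryGroup.localPi E c (n + n) JD v → ℂ))
    (hℳ : ∀ (φ : ↥(localDegPS F E c hcδ hδ hd v n hT₀ hJD χv (1 / 2))) (f Fn : ℂ → UnitaryGroup.localPi E c (n + n) JD v → ℂ),
        (∀ s, IsLocalSiegelSection F E c hcδ hδ hd v n hT₀ hJD χv s (f s)) → (∀ s, IsSmooth F E c v n (f s)) → (∀ s s' : ℂ, ∀ k ∈ K₀, f s k = f s' k) →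
        f (1 / 2) = (φ : UnitaryGroup.localPi E c (n + n) JD v → ℂ) →
        (∀ h, IsQRationalRegularAt (residueFieldCard (v.adicCompletion F)) (1 / 2) fun s => Fn s h) →
        (∀ s : ℂ, 1 < s.re → ∀ h, localIntertwining F E c v n hJD νN (f s) h = aNorm F E c v n χv vol s * Fn s h) →
        ∀ h, ℳ φ h = Fn (1 / 2) h)
    (φ : ↥(localDegPS F E c hcδ hδ hd v n hT₀ hJD χv (1 / 2))) (h₀ : UnitaryGroup.localPi E c (n + n) JD v) (hne : ℳ φ h₀ ≠ 0) :
    ∃ f Fn : ℂ → UnitaryGroup.localPi E c (n + n) JD v → ℂ,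
      (∀ s, IsLocalSiegelSection F E c hcδ hδ hd v n hT₀ hJD χv s (f s)) ∧ (∀ s, IsSmooth F E c v n (f s)) ∧ (∀ s s' : ℂ, ∀ k ∈ K₀, f s k = f s' k) ∧
      f (1 / 2) = (φ : UnitaryGroup.localPi E c (n + n) JD v → ℂ) ∧
      (∀ h, IsQRationalRegularAt (residueFieldCard (v.adicCompletion F)) (1 / 2) fun s => Fn s h) ∧
      (∀ s : ℂ, 1 < s.re → ∀ h, localIntertwining F E c v n hJD νN (f s) h = aNorm F E c v n χv vol s * Fn s h) ∧ Fn (1 / 2) h₀ ≠ 0 := by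
  obtain ⟨f, hS, hsm, hfl, hthr⟩ := exists_flatFamily F E c hcδ hδ hd v n hT₀ hJD χv K₀ hK₀ hIw (1 / 2) φ.2.1 φ.2.2
  obtain ⟨Fn, hreg, hfac⟩ := hA4R f hS hsm hfl
  refine ⟨f, Fn, hS, hsm, hfl, hthr, hreg, hfac, ?_⟩
  rw [← hℳ φ f Fn hS hsm hfl hthr hreg hfac h₀]
  exact hne

include hcδ hδ hd hT₀ hJD hK₀ hIw hA4R hintA haN in
/-- **σ19-(Sp) GLUE, TUPLE CURRENCY**: if an admissible family `f` through `φ₁ + φ₂` has (A4′-R) datum `Fn` with `Fn(½)(h₀) ≠ 0`, then an admissible family through `φ₁` OR one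
through `φ₂` has non-vanishing datum at `(½, h₀)` — the value map `ℳ` of ★ V8a is `ℂ`-linear and `ℳ φ (h₀) = Fn(½)(h₀)` for every admissible pair (★ V1 `value_unique`).
[cite: KudlaSweet1997, §1, Thm. 1.2] [cite: HarrisKudlaSweet1996, §6 (6.16)] [cite: Casselman1980, §3] -/
theorem exists_witness_or_of_add (φ₁ φ₂ : ↥(localDegPS F E c hcδ hδ hd v n hT₀ hJD χv (1 / 2)))
    (f Fn : ℂ → UnitaryGroup.localPi E c (n + n) JD v → ℂ)
    (hS : ∀ s, IsLocalSiegelSection F E c hcδ hδ hd v n hT₀ hJD χv s (f s)) (hsm : ∀ s, IsSmooth F E c v n (f s)) (hfl : ∀ s s' : ℂ, ∀ k ∈ K₀, f s k = f s' k)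
    (hthr : f (1 / 2) = ((φ₁ + φ₂ : ↥(localDegPS F E c hcδ hδ hd v n hT₀ hJD χv (1 / 2))) : UnitaryGroup.localPi E c (n + n) JD v → ℂ))
    (hreg : ∀ h, IsQRationalRegularAt (residueFieldCard (v.adicCompletion F)) (1 / 2) fun s => Fn s h)
    (hfac : ∀ s : ℂ, 1 < s.re → ∀ h, localIntertwining F E c v n hJD νN (f s) h = aNorm F E c v n χv vol s * Fn s h)
    (h₀ : UnitaryGroup.localPi E c (n + n) JD v) (hne : Fn (1 / 2) h₀ ≠ 0) :
    (∃ f₁ Fn₁ : ℂ → UnitaryGroup.localPi E c (n + n) JD v → ℂ,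
      (∀ s, IsLocalSiegelSection F E c hcδ hδ hd v n hT₀ hJD χv s (f₁ s)) ∧ (∀ s, IsSmooth F E c v n (f₁ s)) ∧ (∀ s s' : ℂ, ∀ k ∈ K₀, f₁ s k = f₁ s' k) ∧
      f₁ (1 / 2) = (φ₁ : UnitaryGroup.localPi E c (n + n) JD v → ℂ) ∧
      (∀ h, IsQRationalRegularAt (residueFieldCard (v.adicCompletion F)) (1 / 2) fun s => Fn₁ s h) ∧
      (∀ s : ℂ, 1 < s.re → ∀ h, localIntertwining F E c v n hJD νN (f₁ s) h = aNorm F E c v n χv vol s * Fn₁ s h) ∧ Fn₁ (1 / 2) h₀ ≠ 0) ∨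
    (∃ f₂ Fn₂ : ℂ → UnitaryGroup.localPi E c (n + n) JD v → ℂ,
      (∀ s, IsLocalSiegelSection F E c hcδ hδ hd v n hT₀ hJD χv s (f₂ s)) ∧ (∀ s, IsSmooth F E c v n (f₂ s)) ∧ (∀ s s' : ℂ, ∀ k ∈ K₀, f₂ s k = f₂ s' k) ∧
      f₂ (1 / 2) = (φ₂ : UnitaryGroup.localPi E c (n + n) JD v → ℂ) ∧
      (∀ h, IsQRationalRegularAt (residueFieldCard (v.adicCompletion F)) (1 / 2) fun s => Fn₂ s h) ∧
      (∀ s : ℂ, 1 < s.re → ∀ h, localIntertwining F E c v n hJD νN (f₂ s) h = aNorm F E c v n χv vol s * Fn₂ s h) ∧ Fn₂ (1 / 2) h₀ ≠ 0) := by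
  obtain ⟨ℳ, hℳ⟩ := exists_valueMap F E c hcδ hδ hd v n hT₀ hJD χv νN vol haN K₀ hK₀ hIw hA4R hintA
  have hsum : ℳ (φ₁ + φ₂) h₀ = Fn (1 / 2) h₀ := hℳ (φ₁ + φ₂) f Fn hS hsm hfl hthr hreg hfac h₀
  have hsplit : ℳ φ₁ h₀ + ℳ φ₂ h₀ ≠ 0 := by
    rw [← Pi.add_apply, ← map_add, hsum]; exact hne
  by_cases h₁ : ℳ φ₁ h₀ = 0
  · right
    rw [h₁, zero_add] at hsplit
    exact exists_witness_of_valueMap_ne_zero F E c hcδ hδ hd v n hT₀ hJD χv νN vol K₀ hK₀ hIw hA4R ℳ hℳ φ₂ h₀ hsplit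
  · left
    exact exists_witness_of_valueMap_ne_zero F E c hcδ hδ hd v n hT₀ hJD χv νN vol K₀ hK₀ hIw hA4R ℳ hℳ φ₁ h₀ h₁

include hcδ hδ hd hT₀ hJD hK₀ hIw hA4R hintA haN in
/-- **`hne_of_sum_witness` (LEAD σ21, V8e `𝒜`-currency at `h₀ = 1`)**: for two section maps `𝒜⁺ : V⁺ →ₗ I_v(½, χ_v)`, `𝒜⁻ : V⁻ →ₗ I_v(½, χ_v)` and an admissible family `f`
through `𝒜⁺ Φ + 𝒜⁻ Ψ` with datum `Fn(½)(1) ≠ 0`, either `𝒜⁺ Φ` or `𝒜⁻ Ψ` carries V8e's witness tuple `(f′, Fn′)` with `Fn′(½)(1) ≠ 0`.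
[cite: KudlaSweet1997, §1, Thm. 1.2] [cite: HarrisKudlaSweet1996, §6 (6.16)] -/
theorem hne_of_sum_witness {Vp Vm : Type*} [AddCommGroup Vp] [Module ℂ Vp] [AddCommGroup Vm] [Module ℂ Vm]
    (Ap : Vp →ₗ[ℂ] ↥(localDegPS F E c hcδ hδ hd v n hT₀ hJD χv (1 / 2))) (Am : Vm →ₗ[ℂ] ↥(localDegPS F E c hcδ hδ hd v n hT₀ hJD χv (1 / 2)))
    (Φ : Vp) (Ψ : Vm) (f Fn : ℂ → UnitaryGroup.localPi E c (n + n) JD v → ℂ)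
    (hS : ∀ s, IsLocalSiegelSection F E c hcδ hδ hd v n hT₀ hJD χv s (f s)) (hsm : ∀ s, IsSmooth F E c v n (f s)) (hfl : ∀ s s' : ℂ, ∀ k ∈ K₀, f s k = f s' k)
    (hthr : f (1 / 2) = ((Ap Φ + Am Ψ : ↥(localDegPS F E c hcδ hδ hd v n hT₀ hJD χv (1 / 2))) : UnitaryGroup.localPi E c (n + n) JD v → ℂ))
    (hreg : ∀ h, IsQRationalRegularAt (residueFieldCard (v.adicCompletion F)) (1 / 2) fun s => Fn s h)
    (hfac : ∀ s : ℂ, 1 < s.re → ∀ h, localIntertwining F E c v n hJD νN (f s) h = aNorm F E c v n χv vol s * Fn s h)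
    (hne : Fn (1 / 2) 1 ≠ 0) :
    (∃ f₁ Fn₁ : ℂ → UnitaryGroup.localPi E c (n + n) JD v → ℂ,
      (∀ s, IsLocalSiegelSection F E c hcδ hδ hd v n hT₀ hJD χv s (f₁ s)) ∧ (∀ s, IsSmooth F E c v n (f₁ s)) ∧ (∀ s s' : ℂ, ∀ k ∈ K₀, f₁ s k = f₁ s' k) ∧
      f₁ (1 / 2) = ((Ap Φ : ↥(localDegPS F E c hcδ hδ hd v n hT₀ hJD χv (1 / 2))) : UnitaryGroup.localPi E c (n + n) JD v → ℂ) ∧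
      (∀ h, IsQRationalRegularAt (residueFieldCard (v.adicCompletion F)) (1 / 2) fun s => Fn₁ s h) ∧
      (∀ s : ℂ, 1 < s.re → ∀ h, localIntertwining F E c v n hJD νN (f₁ s) h = aNorm F E c v n χv vol s * Fn₁ s h) ∧ Fn₁ (1 / 2) 1 ≠ 0) ∨
    (∃ f₂ Fn₂ : ℂ → UnitaryGroup.localPi E c (n + n) JD v → ℂ,
      (∀ s, IsLocalSiegelSection F E c hcδ hδ hd v n hT₀ hJD χv s (f₂ s)) ∧ (∀ s, IsSmooth F E c v n (f₂ s)) ∧ (∀ s s' : ℂ, ∀ k ∈ K₀, f₂ s k = f₂ s' k) ∧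
      f₂ (1 / 2) = ((Am Ψ : ↥(localDegPS F E c hcδ hδ hd v n hT₀ hJD χv (1 / 2))) : UnitaryGroup.localPi E c (n + n) JD v → ℂ) ∧
      (∀ h, IsQRationalRegularAt (residueFieldCard (v.adicCompletion F)) (1 / 2) fun s => Fn₂ s h) ∧
      (∀ s : ℂ, 1 < s.re → ∀ h, localIntertwining F E c v n hJD νN (f₂ s) h = aNorm F E c v n χv vol s * Fn₂ s h) ∧ Fn₂ (1 / 2) 1 ≠ 0) :=
  exists_witness_or_of_add F E c hcδ hδ hd v n hT₀ hJD χv νN vol haN K₀ hK₀ hIw hA4R hintA (Ap Φ) (Am Ψ) f Fn hS hsm hfl hthr hreg hfac 1 hne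

end Summit.HodgeConjecture.HodgeConjecture.Cruxes.HLiu418.K2LiuA7ValueSumWitness

end
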